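import Literature.NumberTheory.Automorphic.UnitaryGroupHeisenbergConjFundamentalDomain
import Literature.NumberTheory.Automorphic.UnitaryGroupHeisenbergConjThreeFactorHead
import HarnessLib

/-!
# Divisibility of the conjugated Heisenberg element on the dilated fundamental domain `t⁻¹ 𝓕_N t`:
# the level hypothesis `hval` of the three-factor normal form from valuation bounds on `(m, d(b), x₀(b))`
(Rogawski, *Automorphic Representations of Unitary Groups in Three Variables* (1990), §2.2 (p. 13); Tate (1967), Ch. XV §4.1)

Topic `NumberTheory/Automorphic`; namespace `Literature.NumberTheory.Automorphic.UnitaryGroup`.  THEOREMS ONLY (kernel lane): no `def`,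
no named fact, no instance, no notation, no `sorry`.  Row H5b (FILE 2E) of the T1-qs sub-line of `F0_T1InnerFormTraceIdentity` (cell hodgecm-mathlib,
F0P3a RULING #100 (a)): the hypothesis `hval` of ★ `exists_isCompact_forall_threeFactor` (FILE 2D) — the off-diagonal entries of `π(b⁻¹ub)` are divisible
by `𝔫` — DISCHARGED for `u` in the dilated domain `t⁻¹ 𝓕_N t` (★ `mem_torusConj_image_iff`: `x(u) = M·x₁`, `y(u) = M′·y₁`, `(x₁, y₁) ∈ D_E × 𝓕⁻`,
`M = d₀(t)⁻¹d₁(t)`, `M′ = d₀(t)⁻¹d₂(t) = M·c(M)`) for a torus element `t` with `c(M) = M` (e.g. the rational `t_m = diag(m⁻¹,1,m)` of ★ `exists_rational_torus_diag`,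
`M = m`), from five valuation inequalities at each finite place `v` on `M`, the root values `d₀⁻¹d₁, d₀⁻¹d₂, d₁⁻¹d₂` of `b` and the coordinate `x₀` of the
unipotent part of `b` (`|M|·|d₀⁻¹d₁| ≤ |𝔫|`, `|M|·|d₁⁻¹d₂| ≤ |𝔫|`, `|M|²·|d₀⁻¹d₂|·|½| ≤ |𝔫|`, `|M|·|d₁⁻¹d₂|·|x₀| ≤ |𝔫|`, `|M|·|d₀⁻¹d₁|·|c(x₀)| ≤ |𝔫|`):
the entries are `x′ = d₀⁻¹d₁·M·x₁`, `−c(x′) = −d₁⁻¹d₂·M·c(x₁)`, `z′ = d₀⁻¹d₂·y(u) + x₀c(d₀⁻¹d₁x(u)) − d₀⁻¹d₁x(u)c(x₀) − ½x′c(x′)` and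
`|x₁|_v ≤ 1`, `|c(x₁)|_v ≤ 1` (Tate's domain is finite-integral), `|y₁|_v ≤ |½|_v` (`𝓕⁻ ⊆ ½(z − c z)`, `z ∈ closure D_E`).

* §1 integrality: `isFiniteIntegral_of_mem_closure_adeleFundamentalDomain`, `valued_snd_le_one_of_mem_adeleFundamentalDomain`,
  `valued_conjAdele_snd_le_one`, `valued_coe_snd_le_of_mem_traceZeroFundamentalDomain`, `conjAdele_halfAdele'`.
* §2 **`forall_valued_entry_le_of_mem_torusConj_image`** (the plain half of `hval`) and **`hval_of_mem_torusConj_image`** (both halves, for ANY `𝔫`, from the five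
  inequalities for `𝔫` and for `c⁻¹ • 𝔫`; for a `c`-stable level pass the same hypothesis twice, cf. ★ `valued_conjAdele_snd_le_of_smul_eq`).
* §3 **`exists_isCompact_forall_threeFactor_dilated`** — ★ `exists_isCompact_forall_threeFactor` (FILE 2D) on `t⁻¹ 𝓕_N t` with `hval` discharged: the consumer socket;
  §4 **`exists_rational_torus_threeFactor`** — the same on `𝓕_m = t_m⁻¹ 𝓕_N t_m` for `m ∈ F×` (★ `exists_rational_torus_diag`), inequalities in `|m|_v`.

## References
* J. D. Rogawski, *Automorphic Representations of Unitary Groups in Three Variables*, Ann. of Math. Stud. 123 (1990), §2.2 [Rogawski1990].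
* J. W. S. Cassels, A. Fröhlich (eds.), *Algebraic Number Theory* (1967), Ch. XV §4.1 (Tate) [CasselsFrohlichANT1967].
-/

set_option autoImplicit false

noncomputable section

open Matrix NumberField NumberField.mixedEmbedding IsDedekindDomain Topology
-- `open scoped Classical` is needed to see the Mathlib normed-ring instances on `mixedSpace E` (note H5 of `AdelicGLnGlue`)
open scoped MatrixGroups Pointwise Classical

namespace Literature.NumberTheory.Automorphic

namespace UnitaryGroup

variable {F E : Type} [Field F] [NumberField F] [Field E] [NumberField E] [Algebra F E]
  {c : E ≃ₐ[F] E}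

/-! ## §1 Integrality of the coordinates on `D_E × 𝓕⁻` -/

omit [NumberField F] in
/-- Points of the CLOSURE of Tate's domain are still finite-integral (`∏_v 𝒪_v` is closed). [cite: CasselsFrohlichANT1967, Ch. XV Cor. 4.1.1] -/
theorem isFiniteIntegral_of_mem_closure_adeleFundamentalDomain {x : AdeleRing (𝓞 E) E} (hx : x ∈ closure (adeleFundamentalDomain E)) :
    IsFiniteIntegral E x := by
  have hcl : IsClosed {x : AdeleRing (𝓞 E) E | IsFiniteIntegral E x} := by
    have h : {x : AdeleRing (𝓞 E) E | IsFiniteIntegral E x} =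
        ⋂ v : HeightOneSpectrum (𝓞 E), (fun x : AdeleRing (𝓞 E) E => x.2 v) ⁻¹' (v.adicCompletionIntegers E : Set (v.adicCompletion E)) := by
      ext x; simp [IsFiniteIntegral]
    rw [h]
    exact isClosed_iInter fun v => (Valued.isClosed_valuationSubring _).preimage ((RestrictedProduct.continuous_eval v).comp continuous_snd)
  have hsub : adeleFundamentalDomain E ⊆ {x : AdeleRing (𝓞 E) E | IsFiniteIntegral E x} := fun x hx => hx.1
  exact closure_minimal hsub hcl hx

omit [NumberField F] in
/-- `|x_v| ≤ 1` at every finite place for `x` in the closure of Tate's domain. [cite: CasselsFrohlichANT1967, Ch. XV Def. 4.1.2] -/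
theorem valued_snd_le_one_of_mem_closure {x : AdeleRing (𝓞 E) E} (hx : x ∈ closure (adeleFundamentalDomain E)) (v : HeightOneSpectrum (𝓞 E)) :
    Valued.v (x.2 v) ≤ 1 :=
  (HeightOneSpectrum.mem_adicCompletionIntegers (R := 𝓞 E) E v).mp (isFiniteIntegral_of_mem_closure_adeleFundamentalDomain hx v)

omit [NumberField F] in
/-- `|c(x)_v| ≤ 1` for all `v` once `|x_v| ≤ 1` for all `v` (`c(x)_v = c_*(x_{c⁻¹v})`, ★ `valued_galAdicCompletionMap`). [cite: CasselsFrohlichANT1967, Ch. VII §1.1] -/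
theorem valued_conjAdele_snd_le_one {x : AdeleRing (𝓞 E) E} (hx : ∀ v : HeightOneSpectrum (𝓞 E), Valued.v (x.2 v) ≤ 1) (v : HeightOneSpectrum (𝓞 E)) :
    Valued.v ((conjAdele F E c x).2 v) ≤ 1 := by
  rw [conjAdele_apply, AdeleRing.smul_snd, FiniteAdeleRing.smul_apply, valued_galAdicCompletionMap]
  exact hx _

omit [NumberField F] in
/-- `|y_v| ≤ |½|_v` for `y ∈ 𝓕⁻` (`y = ½(z − c z)` with `z ∈ closure D_E`, ★ `traceZeroFundamentalDomain_subset_image`). [cite: CasselsFrohlichANT1967, Ch. XV Cor. 4.1.1] -/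
theorem valued_coe_snd_le_of_mem_traceZeroFundamentalDomain (hc : c * c = 1) {y : traceZeroAdele F E c} (hy : y ∈ traceZeroFundamentalDomain F E c)
    (v : HeightOneSpectrum (𝓞 E)) :
    Valued.v (((y : AdeleRing (𝓞 E) E)).2 v) ≤ Valued.v ((halfAdele : AdeleRing (𝓞 E) E).2 v) := by
  obtain ⟨z, hz, hzy⟩ := traceZeroFundamentalDomain_subset_image hc hy
  rw [← hzy, coe_adeleMinus]
  change Valued.v ((halfAdele : AdeleRing (𝓞 E) E).2 v * (z.2 v - (conjAdele F E c z).2 v)) ≤ _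
  rw [map_mul]
  refine mul_le_of_le_one_right' ((Valuation.map_sub _ _ _).trans (max_le ?_ ?_))
  · exact valued_snd_le_one_of_mem_closure hz v
  · exact valued_conjAdele_snd_le_one (fun w => valued_snd_le_one_of_mem_closure hz w) v

omit [NumberField F] in
/-- `c(½) = ½` (`2⁻¹ ∈ F`). [folklore] -/
private theorem conjAdele_halfAdele' : conjAdele F E c (halfAdele : AdeleRing (𝓞 E) E) = halfAdele := by
  rw [halfAdele, ← algebraMap_conj]
  congr 1
  rw [RingHom.coe_coe, map_inv₀, map_ofNat]

omit [NumberField F] in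
/-- Components of products, sums, differences, negatives of adèles at a finite place (definitional). [folklore] -/
private theorem snd_apply_ops (x y : AdeleRing (𝓞 E) E) (v : HeightOneSpectrum (𝓞 E)) :
    (x * y).2 v = x.2 v * y.2 v ∧ (x + y).2 v = x.2 v + y.2 v ∧ (x - y).2 v = x.2 v - y.2 v ∧ (-x).2 v = -(x.2 v) :=
  ⟨rfl, rfl, rfl, rfl⟩

/-- Valuation bookkeeping for the `(0,2)` entry (an ordered-monoid computation). [folklore] -/
private theorem val_bookkeeping {Γ : Type*} [LinearOrderedCommGroupWithZero Γ] {r vM vα vβ vγ vx0 vcx0 vh vx1 vcx1 vy1 : Γ}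
    (h3 : vM * vM * vβ * vh ≤ r) (h4 : vM * vγ * vx0 ≤ r) (h5 : vM * vα * vcx0 ≤ r) (hαγ : vα * vγ = vβ)
    (ix : vx1 ≤ 1) (icx : vcx1 ≤ 1) (iy : vy1 ≤ vh) :
    vβ * (vM * vM * vy1) ≤ r ∧ vx0 * (vγ * (vM * vcx1)) ≤ r ∧ vα * (vM * vx1) * vcx0 ≤ r ∧
      vh * (vα * (vM * vx1) * (vγ * (vM * vcx1))) ≤ r := by
  refine ⟨?_, ?_, ?_, ?_⟩
  · calc vβ * (vM * vM * vy1) ≤ vβ * (vM * vM * vh) := mul_le_mul' le_rfl (mul_le_mul' le_rfl iy)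
      _ = vM * vM * vβ * vh := by ac_rfl
      _ ≤ r := h3
  · calc vx0 * (vγ * (vM * vcx1)) ≤ vx0 * (vγ * (vM * 1)) := mul_le_mul' le_rfl (mul_le_mul' le_rfl (mul_le_mul' le_rfl icx))
      _ = vM * vγ * vx0 := by rw [mul_one]; ac_rfl
      _ ≤ r := h4
  · calc vα * (vM * vx1) * vcx0 ≤ vα * (vM * 1) * vcx0 := mul_le_mul' (mul_le_mul' le_rfl (mul_le_mul' le_rfl ix)) le_rfl
      _ = vM * vα * vcx0 := by rw [mul_one]; ac_rfl
      _ ≤ r := h5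
  · calc vh * (vα * (vM * vx1) * (vγ * (vM * vcx1))) ≤ vh * (vα * (vM * 1) * (vγ * (vM * 1))) :=
          mul_le_mul' le_rfl (mul_le_mul' (mul_le_mul' le_rfl (mul_le_mul' le_rfl ix)) (mul_le_mul' le_rfl (mul_le_mul' le_rfl icx)))
      _ = vM * vM * (vα * vγ) * vh := by simp only [mul_one]; ac_rfl
      _ = vM * vM * vβ * vh := by rw [hαγ]
      _ ≤ r := h3

/-! ## §2 The divisibility of the entries of `π(b⁻¹ub)` for `u ∈ t⁻¹ 𝓕_N t` -/

/-- **THE LEVEL HYPOTHESIS ON THE DILATED DOMAIN (plain half).** For a torus element `t = diag(d(t))` with `c`-fixed root value `M = d₀(t)⁻¹d₁(t)`, `b ∈ B(𝔸_F)`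
with root values `d₀⁻¹d₁, d₀⁻¹d₂, d₁⁻¹d₂` (`d = diagUnit b`) and unipotent coordinate `x₀ = x((torusPart b)⁻¹ b)`, a level `𝔫`, and `u ∈ t⁻¹ 𝓕_N t`: if at every
finite `v` the five products `|M||d₀⁻¹d₁|`, `|M||d₁⁻¹d₂|`, `|M|²|d₀⁻¹d₂||½|`, `|M||d₁⁻¹d₂||x₀|`, `|M||d₀⁻¹d₁||c(x₀)|` are `≤ |𝔫|_v`, then every off-diagonal entry of
`π(b⁻¹ub)` has `v`-adic valuation `≤ |𝔫|_v`. [cite: Rogawski1990, §2.2 (p. 13)] -/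
theorem forall_valued_entry_le_of_mem_torusConj_image (hc : c * c = 1) (t : borelAdelic F E c 3)
    (ht : (t : (quasiSplit F E c 3).Adelic) ∈ torusAdelic F E c 3) (hfix : conjAdele F E c ((((diagUnit t.2 0)⁻¹ * diagUnit t.2 1 : (AdeleRing (𝓞 E) E)ˣ)) : AdeleRing (𝓞 E) E) = ((((diagUnit t.2 0)⁻¹ * diagUnit t.2 1 : (AdeleRing (𝓞 E) E)ˣ)) : AdeleRing (𝓞 E) E))
    (b : borelAdelic F E c 3) (𝔫 : Ideal (𝓞 E))
    (hval : ∀ v : HeightOneSpectrum (𝓞 E),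
      Valued.v ((((((diagUnit t.2 0)⁻¹ * diagUnit t.2 1 : (AdeleRing (𝓞 E) E)ˣ)) : AdeleRing (𝓞 E) E)).2 v) * Valued.v ((((((diagUnit b.2 0)⁻¹ * diagUnit b.2 1 : (AdeleRing (𝓞 E) E)ˣ)) : AdeleRing (𝓞 E) E)).2 v) ≤ idealRadius E v 𝔫 ∧
      Valued.v ((((((diagUnit t.2 0)⁻¹ * diagUnit t.2 1 : (AdeleRing (𝓞 E) E)ˣ)) : AdeleRing (𝓞 E) E)).2 v) * Valued.v ((((((diagUnit b.2 1)⁻¹ * diagUnit b.2 2 : (AdeleRing (𝓞 E) E)ˣ)) : AdeleRing (𝓞 E) E)).2 v) ≤ idealRadius E v 𝔫 ∧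
      Valued.v ((((((diagUnit t.2 0)⁻¹ * diagUnit t.2 1 : (AdeleRing (𝓞 E) E)ˣ)) : AdeleRing (𝓞 E) E)).2 v) * Valued.v ((((((diagUnit t.2 0)⁻¹ * diagUnit t.2 1 : (AdeleRing (𝓞 E) E)ˣ)) : AdeleRing (𝓞 E) E)).2 v) * Valued.v ((((((diagUnit b.2 0)⁻¹ * diagUnit b.2 2 : (AdeleRing (𝓞 E) E)ˣ)) : AdeleRing (𝓞 E) E)).2 v) *
          Valued.v ((halfAdele : AdeleRing (𝓞 E) E).2 v) ≤ idealRadius E v 𝔫 ∧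
      Valued.v ((((((diagUnit t.2 0)⁻¹ * diagUnit t.2 1 : (AdeleRing (𝓞 E) E)ˣ)) : AdeleRing (𝓞 E) E)).2 v) * Valued.v ((((((diagUnit b.2 1)⁻¹ * diagUnit b.2 2 : (AdeleRing (𝓞 E) E)ˣ)) : AdeleRing (𝓞 E) E)).2 v) * Valued.v ((coordX (⟨(((torusPart b)⁻¹ * b : borelAdelic F E c 3) : (quasiSplit F E c 3).Adelic), torusPart_inv_mul_mem_adelicUnipotent b⟩ :
            adelicUnipotent F E c 3)).2 v) ≤ idealRadius E v 𝔫 ∧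
      Valued.v ((((((diagUnit t.2 0)⁻¹ * diagUnit t.2 1 : (AdeleRing (𝓞 E) E)ˣ)) : AdeleRing (𝓞 E) E)).2 v) * Valued.v ((((((diagUnit b.2 0)⁻¹ * diagUnit b.2 1 : (AdeleRing (𝓞 E) E)ˣ)) : AdeleRing (𝓞 E) E)).2 v) * Valued.v ((conjAdele F E c (coordX (⟨(((torusPart b)⁻¹ * b : borelAdelic F E c 3) : (quasiSplit F E c 3).Adelic), torusPart_inv_mul_mem_adelicUnipotent b⟩ :
            adelicUnipotent F E c 3))).2 v) ≤ idealRadius E v 𝔫)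
    {u : adelicUnipotent F E c 3} (hu : u ∈ (fun v : adelicUnipotent F E c 3 => (⟨(t : (quasiSplit F E c 3).Adelic)⁻¹ * (v : (quasiSplit F E c 3).Adelic) * (t : (quasiSplit F E c 3).Adelic),
        borel_inv_mul_mul_mem_adelicUnipotent t v⟩ : adelicUnipotent F E c 3)) '' heisFundamentalDomain F E c hc) :
    ∀ i j : Fin 3, i ≠ j → ∀ v : HeightOneSpectrum (𝓞 E),
      Valued.v ((((adelicVal F E c 3 _ ((b : (quasiSplit F E c 3).Adelic)⁻¹ * (u : (quasiSplit F E c 3).Adelic) * (b : (quasiSplit F E c 3).Adelic)) :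
            GL (Fin 3) (AdeleRing (𝓞 E) E)) : Matrix (Fin 3) (Fin 3) (AdeleRing (𝓞 E) E)) i j).2 v) ≤ idealRadius E v 𝔫 := by
  obtain ⟨x₁, hx₁, y₁, hy₁, hxu, hyu⟩ := (mem_torusConj_image_iff hc t ht u).1 hu
  obtain ⟨hcαt, hαγt⟩ := conjAdele_rootOne_eq (F := F) (E := E) (c := c) t
  obtain ⟨hcαb, hαγb⟩ := conjAdele_rootOne_eq (F := F) (E := E) (c := c) b
  -- `γ(t) = M`, so `M′ = M·M`
  have hγt : ((((diagUnit t.2 1)⁻¹ * diagUnit t.2 2 : (AdeleRing (𝓞 E) E)ˣ)) : AdeleRing (𝓞 E) E) = ((((diagUnit t.2 0)⁻¹ * diagUnit t.2 1 : (AdeleRing (𝓞 E) E)ˣ)) : AdeleRing (𝓞 E) E) := hcαt.symm.trans hfix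
  have hβt : ((((diagUnit t.2 0)⁻¹ * diagUnit t.2 2 : (AdeleRing (𝓞 E) E)ˣ)) : AdeleRing (𝓞 E) E) = ((((diagUnit t.2 0)⁻¹ * diagUnit t.2 1 : (AdeleRing (𝓞 E) E)ˣ)) : AdeleRing (𝓞 E) E) * ((((diagUnit t.2 0)⁻¹ * diagUnit t.2 1 : (AdeleRing (𝓞 E) E)ˣ)) : AdeleRing (𝓞 E) E) := by rw [← hαγt, hγt]
  -- the coordinates of `w = b⁻¹ u b`
  have hx' : coordX ⟨(b : (quasiSplit F E c 3).Adelic)⁻¹ * (u : (quasiSplit F E c 3).Adelic) * (b : (quasiSplit F E c 3).Adelic),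
        borel_inv_mul_mul_mem_adelicUnipotent b u⟩ = ((((diagUnit b.2 0)⁻¹ * diagUnit b.2 1 : (AdeleRing (𝓞 E) E)ˣ)) : AdeleRing (𝓞 E) E) * (((((diagUnit t.2 0)⁻¹ * diagUnit t.2 1 : (AdeleRing (𝓞 E) E)ˣ)) : AdeleRing (𝓞 E) E) * x₁) := by
    rw [coordX_borel_conj b u, hxu]
  have hy' := coe_coordY_borel_conj hc b u
  -- integrality of `x₁`, `c x₁`, the bound on `y₁` and `c y(u) = −y(u)`
  have ix : ∀ w, Valued.v (x₁.2 w) ≤ 1 := fun w => valued_snd_le_one_of_mem_closure (subset_closure hx₁) w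
  have icx : ∀ w, Valued.v ((conjAdele F E c x₁).2 w) ≤ 1 := fun w => valued_conjAdele_snd_le_one ix w
  have iy : ∀ w, Valued.v (((y₁ : AdeleRing (𝓞 E) E)).2 w) ≤ Valued.v ((halfAdele : AdeleRing (𝓞 E) E).2 w) :=
    fun w => valued_coe_snd_le_of_mem_traceZeroFundamentalDomain hc hy₁ w
  intro i j hij v
  obtain ⟨h1, h2, h3, h4, h5⟩ := hval v
  have hcM : ∀ w, Valued.v ((conjAdele F E c ((((diagUnit t.2 0)⁻¹ * diagUnit t.2 1 : (AdeleRing (𝓞 E) E)ˣ)) : AdeleRing (𝓞 E) E)).2 w) = Valued.v ((((((diagUnit t.2 0)⁻¹ * diagUnit t.2 1 : (AdeleRing (𝓞 E) E)ˣ)) : AdeleRing (𝓞 E) E)).2 w) := fun w => by rw [hfix]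
  -- the three entries
  have ex : Valued.v ((coordX ⟨(b : (quasiSplit F E c 3).Adelic)⁻¹ * (u : (quasiSplit F E c 3).Adelic) * (b : (quasiSplit F E c 3).Adelic),
        borel_inv_mul_mul_mem_adelicUnipotent b u⟩).2 v) ≤ idealRadius E v 𝔫 := by
    rw [hx']
    change Valued.v ((((((diagUnit b.2 0)⁻¹ * diagUnit b.2 1 : (AdeleRing (𝓞 E) E)ˣ)) : AdeleRing (𝓞 E) E)).2 v * (((((((diagUnit t.2 0)⁻¹ * diagUnit t.2 1 : (AdeleRing (𝓞 E) E)ˣ)) : AdeleRing (𝓞 E) E)).2 v) * x₁.2 v)) ≤ _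
    rw [map_mul, map_mul]
    calc Valued.v ((((((diagUnit b.2 0)⁻¹ * diagUnit b.2 1 : (AdeleRing (𝓞 E) E)ˣ)) : AdeleRing (𝓞 E) E)).2 v) * (Valued.v ((((((diagUnit t.2 0)⁻¹ * diagUnit t.2 1 : (AdeleRing (𝓞 E) E)ˣ)) : AdeleRing (𝓞 E) E)).2 v) * Valued.v (x₁.2 v))
        ≤ Valued.v ((((((diagUnit b.2 0)⁻¹ * diagUnit b.2 1 : (AdeleRing (𝓞 E) E)ˣ)) : AdeleRing (𝓞 E) E)).2 v) * (Valued.v ((((((diagUnit t.2 0)⁻¹ * diagUnit t.2 1 : (AdeleRing (𝓞 E) E)ˣ)) : AdeleRing (𝓞 E) E)).2 v) * 1) := mul_le_mul' le_rfl (mul_le_mul' le_rfl (ix v))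
      _ = Valued.v ((((((diagUnit t.2 0)⁻¹ * diagUnit t.2 1 : (AdeleRing (𝓞 E) E)ˣ)) : AdeleRing (𝓞 E) E)).2 v) * Valued.v ((((((diagUnit b.2 0)⁻¹ * diagUnit b.2 1 : (AdeleRing (𝓞 E) E)ˣ)) : AdeleRing (𝓞 E) E)).2 v) := by rw [mul_one, mul_comm]
      _ ≤ idealRadius E v 𝔫 := h1
  have ecx : Valued.v ((conjAdele F E c (coordX ⟨(b : (quasiSplit F E c 3).Adelic)⁻¹ * (u : (quasiSplit F E c 3).Adelic) * (b : (quasiSplit F E c 3).Adelic),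
        borel_inv_mul_mul_mem_adelicUnipotent b u⟩)).2 v) ≤ idealRadius E v 𝔫 := by
    rw [hx', map_mul, map_mul, hcαb]
    change Valued.v ((((((diagUnit b.2 1)⁻¹ * diagUnit b.2 2 : (AdeleRing (𝓞 E) E)ˣ)) : AdeleRing (𝓞 E) E)).2 v * ((conjAdele F E c ((((diagUnit t.2 0)⁻¹ * diagUnit t.2 1 : (AdeleRing (𝓞 E) E)ˣ)) : AdeleRing (𝓞 E) E)).2 v * (conjAdele F E c x₁).2 v)) ≤ _
    rw [map_mul, map_mul, hcM]
    calc Valued.v ((((((diagUnit b.2 1)⁻¹ * diagUnit b.2 2 : (AdeleRing (𝓞 E) E)ˣ)) : AdeleRing (𝓞 E) E)).2 v) * (Valued.v ((((((diagUnit t.2 0)⁻¹ * diagUnit t.2 1 : (AdeleRing (𝓞 E) E)ˣ)) : AdeleRing (𝓞 E) E)).2 v) * Valued.v ((conjAdele F E c x₁).2 v))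
        ≤ Valued.v ((((((diagUnit b.2 1)⁻¹ * diagUnit b.2 2 : (AdeleRing (𝓞 E) E)ˣ)) : AdeleRing (𝓞 E) E)).2 v) * (Valued.v ((((((diagUnit t.2 0)⁻¹ * diagUnit t.2 1 : (AdeleRing (𝓞 E) E)ˣ)) : AdeleRing (𝓞 E) E)).2 v) * 1) := mul_le_mul' le_rfl (mul_le_mul' le_rfl (icx v))
      _ = Valued.v ((((((diagUnit t.2 0)⁻¹ * diagUnit t.2 1 : (AdeleRing (𝓞 E) E)ˣ)) : AdeleRing (𝓞 E) E)).2 v) * Valued.v ((((((diagUnit b.2 1)⁻¹ * diagUnit b.2 2 : (AdeleRing (𝓞 E) E)ˣ)) : AdeleRing (𝓞 E) E)).2 v) := by rw [mul_one, mul_comm]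
      _ ≤ idealRadius E v 𝔫 := h2
  have ez : Valued.v ((heisZ (c := c) (coordX ⟨(b : (quasiSplit F E c 3).Adelic)⁻¹ * (u : (quasiSplit F E c 3).Adelic) * (b : (quasiSplit F E c 3).Adelic),
        borel_inv_mul_mul_mem_adelicUnipotent b u⟩)
      ((coordY hc ⟨(b : (quasiSplit F E c 3).Adelic)⁻¹ * (u : (quasiSplit F E c 3).Adelic) * (b : (quasiSplit F E c 3).Adelic),
        borel_inv_mul_mul_mem_adelicUnipotent b u⟩ : traceZeroAdele F E c) : AdeleRing (𝓞 E) E)).2 v) ≤ idealRadius E v 𝔫 := by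
    have hαγv : Valued.v ((((((diagUnit b.2 0)⁻¹ * diagUnit b.2 1 : (AdeleRing (𝓞 E) E)ˣ)) : AdeleRing (𝓞 E) E)).2 v) * Valued.v ((((((diagUnit b.2 1)⁻¹ * diagUnit b.2 2 : (AdeleRing (𝓞 E) E)ˣ)) : AdeleRing (𝓞 E) E)).2 v) = Valued.v ((((((diagUnit b.2 0)⁻¹ * diagUnit b.2 2 : (AdeleRing (𝓞 E) E)ˣ)) : AdeleRing (𝓞 E) E)).2 v) := by
      rw [← map_mul, ← (snd_apply_ops _ _ v).1, hαγb]
    obtain ⟨k1, k2, k3, k4⟩ := val_bookkeeping h3 h4 h5 hαγv (ix v) (icx v) (iy v)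
    rw [heisZ, hy', hx', hyu, hβt, hxu, map_mul, map_mul, hcαb, hfix]
    simp only [(snd_apply_ops _ _ v).1, (snd_apply_ops _ _ v).2.1, (snd_apply_ops _ _ v).2.2.1]
    refine (Valuation.map_sub _ _ _).trans (max_le ((Valuation.map_add _ _ _).trans (max_le ?_
      ((Valuation.map_sub _ _ _).trans (max_le ?_ ?_)))) ?_)
    · simpa only [map_mul] using k1
    · simpa only [map_mul] using k2
    · simpa only [map_mul] using k3
    · simpa only [map_mul, hcM] using k4
  -- the entries of `π(b⁻¹ub) = 1 + x′E₀₁ − c(x′)E₁₂ + z′E₀₂`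
  have hw : ((adelicVal F E c 3 _ ((b : (quasiSplit F E c 3).Adelic)⁻¹ * (u : (quasiSplit F E c 3).Adelic) * (b : (quasiSplit F E c 3).Adelic)) :
            GL (Fin 3) (AdeleRing (𝓞 E) E)) : Matrix (Fin 3) (Fin 3) (AdeleRing (𝓞 E) E)) =
      1 + Matrix.single 0 1 (coordX ⟨(b : (quasiSplit F E c 3).Adelic)⁻¹ * (u : (quasiSplit F E c 3).Adelic) * (b : (quasiSplit F E c 3).Adelic),
        borel_inv_mul_mul_mem_adelicUnipotent b u⟩) + Matrix.single 1 2 (-conjAdele F E c (coordX ⟨(b : (quasiSplit F E c 3).Adelic)⁻¹ * (u : (quasiSplit F E c 3).Adelic) * (b : (quasiSplit F E c 3).Adelic),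
        borel_inv_mul_mul_mem_adelicUnipotent b u⟩)) +
        Matrix.single 0 2 (heisZ (c := c) (coordX ⟨(b : (quasiSplit F E c 3).Adelic)⁻¹ * (u : (quasiSplit F E c 3).Adelic) * (b : (quasiSplit F E c 3).Adelic),
        borel_inv_mul_mul_mem_adelicUnipotent b u⟩)
          ((coordY hc ⟨(b : (quasiSplit F E c 3).Adelic)⁻¹ * (u : (quasiSplit F E c 3).Adelic) * (b : (quasiSplit F E c 3).Adelic),
        borel_inv_mul_mul_mem_adelicUnipotent b u⟩ : traceZeroAdele F E c) : AdeleRing (𝓞 E) E)) :=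
    coe_adelicVal_eq_one_add_single hc ⟨(b : (quasiSplit F E c 3).Adelic)⁻¹ * (u : (quasiSplit F E c 3).Adelic) * (b : (quasiSplit F E c 3).Adelic),
        borel_inv_mul_mul_mem_adelicUnipotent b u⟩
  have h0 : Valued.v ((0 : AdeleRing (𝓞 E) E).2 v) ≤ idealRadius E v 𝔫 := by
    change Valued.v (0 : v.adicCompletion E) ≤ _
    rw [Valuation.map_zero]; exact zero_le
  rw [hw]
  fin_cases i <;> fin_cases j
  all_goals first | exact absurd rfl hij | simp only [Matrix.add_apply, Matrix.one_apply, Matrix.single_apply]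
  all_goals simp
  all_goals first | exact ex | exact ez | exact h0 | (rw [(snd_apply_ops _ 0 v).2.2.2, Valuation.map_neg]; exact ecx)

omit [NumberField F] in
/-- The radius `|𝔫|_w` is Galois-invariant: `|σ • 𝔫|_{σ w} = |𝔫|_w` (restated privately, as in ★ `UnitaryGroupHeisenbergConjLevel`). [folklore] -/
private theorem idealRadius_smul'' (σ : E ≃ₐ[F] E) (w : HeightOneSpectrum (𝓞 E)) (𝔫 : Ideal (𝓞 E)) :
    idealRadius E (σ • w) (σ • 𝔫) = idealRadius E w 𝔫 := by
  classical
  rcases eq_or_ne 𝔫 ⊥ with rfl | h𝔫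
  · rw [Ideal.smul_bot, idealRadius, idealRadius, FractionalIdeal.coeIdeal_bot, FractionalIdeal.count_zero,
      FractionalIdeal.count_zero]
  · have hσ𝔫 : σ • 𝔫 ≠ ⊥ := fun h => h𝔫 ((Ideal.smul_eq_bot_iff σ 𝔫).mp h)
    rw [idealRadius, idealRadius, FractionalIdeal.count_coe E _ hσ𝔫, FractionalIdeal.count_coe E _ h𝔫,
      HeightOneSpectrum.count_smul_asIdeal σ w h𝔫]

/-- **Both halves of `hval` for an ARBITRARY level `𝔫`**: the conjugate condition at `v` for `𝔫` is the plain condition at `c⁻¹v` for `c⁻¹ • 𝔫`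
(`|c(e)_v| = |e_{c⁻¹ v}|`, `|c⁻¹ • 𝔫|_{c⁻¹ v} = |𝔫|_v`), so the five inequalities for `𝔫` AND for `c⁻¹ • 𝔫` suffice. [cite: Rogawski1990, §2.2 (p. 13)] -/
theorem hval_of_mem_torusConj_image (hc : c * c = 1) (t : borelAdelic F E c 3)
    (ht : (t : (quasiSplit F E c 3).Adelic) ∈ torusAdelic F E c 3) (hfix : conjAdele F E c ((((diagUnit t.2 0)⁻¹ * diagUnit t.2 1 : (AdeleRing (𝓞 E) E)ˣ)) : AdeleRing (𝓞 E) E) = ((((diagUnit t.2 0)⁻¹ * diagUnit t.2 1 : (AdeleRing (𝓞 E) E)ˣ)) : AdeleRing (𝓞 E) E))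
    (b : borelAdelic F E c 3) (𝔫 : Ideal (𝓞 E))
    (hval : ∀ v : HeightOneSpectrum (𝓞 E),
      Valued.v ((((((diagUnit t.2 0)⁻¹ * diagUnit t.2 1 : (AdeleRing (𝓞 E) E)ˣ)) : AdeleRing (𝓞 E) E)).2 v) * Valued.v ((((((diagUnit b.2 0)⁻¹ * diagUnit b.2 1 : (AdeleRing (𝓞 E) E)ˣ)) : AdeleRing (𝓞 E) E)).2 v) ≤ idealRadius E v 𝔫 ∧
      Valued.v ((((((diagUnit t.2 0)⁻¹ * diagUnit t.2 1 : (AdeleRing (𝓞 E) E)ˣ)) : AdeleRing (𝓞 E) E)).2 v) * Valued.v ((((((diagUnit b.2 1)⁻¹ * diagUnit b.2 2 : (AdeleRing (𝓞 E) E)ˣ)) : AdeleRing (𝓞 E) E)).2 v) ≤ idealRadius E v 𝔫 ∧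
      Valued.v ((((((diagUnit t.2 0)⁻¹ * diagUnit t.2 1 : (AdeleRing (𝓞 E) E)ˣ)) : AdeleRing (𝓞 E) E)).2 v) * Valued.v ((((((diagUnit t.2 0)⁻¹ * diagUnit t.2 1 : (AdeleRing (𝓞 E) E)ˣ)) : AdeleRing (𝓞 E) E)).2 v) * Valued.v ((((((diagUnit b.2 0)⁻¹ * diagUnit b.2 2 : (AdeleRing (𝓞 E) E)ˣ)) : AdeleRing (𝓞 E) E)).2 v) *
          Valued.v ((halfAdele : AdeleRing (𝓞 E) E).2 v) ≤ idealRadius E v 𝔫 ∧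
      Valued.v ((((((diagUnit t.2 0)⁻¹ * diagUnit t.2 1 : (AdeleRing (𝓞 E) E)ˣ)) : AdeleRing (𝓞 E) E)).2 v) * Valued.v ((((((diagUnit b.2 1)⁻¹ * diagUnit b.2 2 : (AdeleRing (𝓞 E) E)ˣ)) : AdeleRing (𝓞 E) E)).2 v) * Valued.v ((coordX (⟨(((torusPart b)⁻¹ * b : borelAdelic F E c 3) : (quasiSplit F E c 3).Adelic), torusPart_inv_mul_mem_adelicUnipotent b⟩ :
            adelicUnipotent F E c 3)).2 v) ≤ idealRadius E v 𝔫 ∧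
      Valued.v ((((((diagUnit t.2 0)⁻¹ * diagUnit t.2 1 : (AdeleRing (𝓞 E) E)ˣ)) : AdeleRing (𝓞 E) E)).2 v) * Valued.v ((((((diagUnit b.2 0)⁻¹ * diagUnit b.2 1 : (AdeleRing (𝓞 E) E)ˣ)) : AdeleRing (𝓞 E) E)).2 v) * Valued.v ((conjAdele F E c (coordX (⟨(((torusPart b)⁻¹ * b : borelAdelic F E c 3) : (quasiSplit F E c 3).Adelic), torusPart_inv_mul_mem_adelicUnipotent b⟩ :
            adelicUnipotent F E c 3))).2 v) ≤ idealRadius E v 𝔫)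
    (hval' : ∀ v : HeightOneSpectrum (𝓞 E),
      Valued.v ((((((diagUnit t.2 0)⁻¹ * diagUnit t.2 1 : (AdeleRing (𝓞 E) E)ˣ)) : AdeleRing (𝓞 E) E)).2 v) * Valued.v ((((((diagUnit b.2 0)⁻¹ * diagUnit b.2 1 : (AdeleRing (𝓞 E) E)ˣ)) : AdeleRing (𝓞 E) E)).2 v) ≤ idealRadius E v (c⁻¹ • 𝔫) ∧
      Valued.v ((((((diagUnit t.2 0)⁻¹ * diagUnit t.2 1 : (AdeleRing (𝓞 E) E)ˣ)) : AdeleRing (𝓞 E) E)).2 v) * Valued.v ((((((diagUnit b.2 1)⁻¹ * diagUnit b.2 2 : (AdeleRing (𝓞 E) E)ˣ)) : AdeleRing (𝓞 E) E)).2 v) ≤ idealRadius E v (c⁻¹ • 𝔫) ∧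
      Valued.v ((((((diagUnit t.2 0)⁻¹ * diagUnit t.2 1 : (AdeleRing (𝓞 E) E)ˣ)) : AdeleRing (𝓞 E) E)).2 v) * Valued.v ((((((diagUnit t.2 0)⁻¹ * diagUnit t.2 1 : (AdeleRing (𝓞 E) E)ˣ)) : AdeleRing (𝓞 E) E)).2 v) * Valued.v ((((((diagUnit b.2 0)⁻¹ * diagUnit b.2 2 : (AdeleRing (𝓞 E) E)ˣ)) : AdeleRing (𝓞 E) E)).2 v) *
          Valued.v ((halfAdele : AdeleRing (𝓞 E) E).2 v) ≤ idealRadius E v (c⁻¹ • 𝔫) ∧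
      Valued.v ((((((diagUnit t.2 0)⁻¹ * diagUnit t.2 1 : (AdeleRing (𝓞 E) E)ˣ)) : AdeleRing (𝓞 E) E)).2 v) * Valued.v ((((((diagUnit b.2 1)⁻¹ * diagUnit b.2 2 : (AdeleRing (𝓞 E) E)ˣ)) : AdeleRing (𝓞 E) E)).2 v) * Valued.v ((coordX (⟨(((torusPart b)⁻¹ * b : borelAdelic F E c 3) : (quasiSplit F E c 3).Adelic), torusPart_inv_mul_mem_adelicUnipotent b⟩ :
            adelicUnipotent F E c 3)).2 v) ≤ idealRadius E v (c⁻¹ • 𝔫) ∧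
      Valued.v ((((((diagUnit t.2 0)⁻¹ * diagUnit t.2 1 : (AdeleRing (𝓞 E) E)ˣ)) : AdeleRing (𝓞 E) E)).2 v) * Valued.v ((((((diagUnit b.2 0)⁻¹ * diagUnit b.2 1 : (AdeleRing (𝓞 E) E)ˣ)) : AdeleRing (𝓞 E) E)).2 v) * Valued.v ((conjAdele F E c (coordX (⟨(((torusPart b)⁻¹ * b : borelAdelic F E c 3) : (quasiSplit F E c 3).Adelic), torusPart_inv_mul_mem_adelicUnipotent b⟩ :
            adelicUnipotent F E c 3))).2 v) ≤ idealRadius E v (c⁻¹ • 𝔫))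
    {u : adelicUnipotent F E c 3} (hu : u ∈ (fun v : adelicUnipotent F E c 3 => (⟨(t : (quasiSplit F E c 3).Adelic)⁻¹ * (v : (quasiSplit F E c 3).Adelic) * (t : (quasiSplit F E c 3).Adelic),
        borel_inv_mul_mul_mem_adelicUnipotent t v⟩ : adelicUnipotent F E c 3)) '' heisFundamentalDomain F E c hc) :
    ∀ i j : Fin 3, i ≠ j → ∀ v : HeightOneSpectrum (𝓞 E),
      Valued.v ((((adelicVal F E c 3 _ ((b : (quasiSplit F E c 3).Adelic)⁻¹ * (u : (quasiSplit F E c 3).Adelic) * (b : (quasiSplit F E c 3).Adelic)) :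
            GL (Fin 3) (AdeleRing (𝓞 E) E)) : Matrix (Fin 3) (Fin 3) (AdeleRing (𝓞 E) E)) i j).2 v) ≤ idealRadius E v 𝔫 ∧
      Valued.v ((conjAdele F E c (((adelicVal F E c 3 _ ((b : (quasiSplit F E c 3).Adelic)⁻¹ * (u : (quasiSplit F E c 3).Adelic) * (b : (quasiSplit F E c 3).Adelic)) :
            GL (Fin 3) (AdeleRing (𝓞 E) E)) : Matrix (Fin 3) (Fin 3) (AdeleRing (𝓞 E) E)) i j)).2 v) ≤ idealRadius E v 𝔫 := by
  intro i j hij v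
  refine ⟨forall_valued_entry_le_of_mem_torusConj_image hc t ht hfix b 𝔫 hval hu i j hij v, ?_⟩
  rw [conjAdele_apply, AdeleRing.smul_snd, FiniteAdeleRing.smul_apply, valued_galAdicCompletionMap, ← idealRadius_smul'' (F := F) c⁻¹ v 𝔫]
  exact forall_valued_entry_le_of_mem_torusConj_image hc t ht hfix b (c⁻¹ • 𝔫) hval' hu i j hij (c⁻¹ • v)

/-! ## §3 The packaged three-factor normal form on the dilated domain -/

/-- **THE THREE-FACTOR NORMAL FORM ON `t⁻¹ 𝓕_N t` (consumer socket of the H5 HEAD).** For a torus element `t` with `c`-fixed root value `M` and a compact `Ω ⊆ N(𝔸_F)` there are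
a compact set of directions `S` and `C ≥ 0` such that for all `b ∈ B(𝔸_F)` with unipotent part in `Ω`, all `k` with `π k ∈ K_∞·GL₃(𝒪̂_E)`, every level `𝔫` satisfying the five valuation
inequalities at every finite place for `𝔫` and for `c⁻¹ • 𝔫` (equal for a `c`-stable level), and every `u ∈ t⁻¹ 𝓕_N t`:
`π((bk)⁻¹ u (bk)) = ι∞(expGL(t₁•X₁) expGL(t₂•X₂) expGL(t₃•X₃)) · w` with `Xᵢ ∈ S`, `w ∈ K(𝔫)`, `|tᵢ| ≤ C·ρ(d)` (★ `exists_isCompact_forall_threeFactor` at the compact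
superset of `t⁻¹ 𝓕_N t` of ★ `exists_isCompact_borelConj_heisFundamentalDomain_subset`). [cite: Rogawski1990, §2.2 (p. 13)] -/
theorem exists_isCompact_forall_threeFactor_dilated (hc : c * c = 1) (t : borelAdelic F E c 3)
    (ht : (t : (quasiSplit F E c 3).Adelic) ∈ torusAdelic F E c 3) (hfix : conjAdele F E c ((((diagUnit t.2 0)⁻¹ * diagUnit t.2 1 : (AdeleRing (𝓞 E) E)ˣ)) : AdeleRing (𝓞 E) E) = ((((diagUnit t.2 0)⁻¹ * diagUnit t.2 1 : (AdeleRing (𝓞 E) E)ˣ)) : AdeleRing (𝓞 E) E))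
    {Ω : Set (adelicUnipotent F E c 3)} (hΩ : IsCompact Ω) :
    ∃ S : Set (Matrix (Fin 3) (Fin 3) (mixedSpace E)), IsCompact S ∧ ∃ C : ℝ, 0 ≤ C ∧
      ∀ (b : borelAdelic F E c 3) (k : (quasiSplit F E c 3).Adelic),
        adelicVal F E c 3 _ k ∈ standardMaximalCompactGL 3 E →
        (⟨(((torusPart b)⁻¹ * b : borelAdelic F E c 3) : (quasiSplit F E c 3).Adelic), torusPart_inv_mul_mem_adelicUnipotent b⟩ :
          adelicUnipotent F E c 3) ∈ Ω →
        ∀ 𝔫 : Ideal (𝓞 E),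
          (∀ v : HeightOneSpectrum (𝓞 E),
      Valued.v ((((((diagUnit t.2 0)⁻¹ * diagUnit t.2 1 : (AdeleRing (𝓞 E) E)ˣ)) : AdeleRing (𝓞 E) E)).2 v) * Valued.v ((((((diagUnit b.2 0)⁻¹ * diagUnit b.2 1 : (AdeleRing (𝓞 E) E)ˣ)) : AdeleRing (𝓞 E) E)).2 v) ≤ idealRadius E v 𝔫 ∧
      Valued.v ((((((diagUnit t.2 0)⁻¹ * diagUnit t.2 1 : (AdeleRing (𝓞 E) E)ˣ)) : AdeleRing (𝓞 E) E)).2 v) * Valued.v ((((((diagUnit b.2 1)⁻¹ * diagUnit b.2 2 : (AdeleRing (𝓞 E) E)ˣ)) : AdeleRing (𝓞 E) E)).2 v) ≤ idealRadius E v 𝔫 ∧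
      Valued.v ((((((diagUnit t.2 0)⁻¹ * diagUnit t.2 1 : (AdeleRing (𝓞 E) E)ˣ)) : AdeleRing (𝓞 E) E)).2 v) * Valued.v ((((((diagUnit t.2 0)⁻¹ * diagUnit t.2 1 : (AdeleRing (𝓞 E) E)ˣ)) : AdeleRing (𝓞 E) E)).2 v) * Valued.v ((((((diagUnit b.2 0)⁻¹ * diagUnit b.2 2 : (AdeleRing (𝓞 E) E)ˣ)) : AdeleRing (𝓞 E) E)).2 v) *
          Valued.v ((halfAdele : AdeleRing (𝓞 E) E).2 v) ≤ idealRadius E v 𝔫 ∧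
      Valued.v ((((((diagUnit t.2 0)⁻¹ * diagUnit t.2 1 : (AdeleRing (𝓞 E) E)ˣ)) : AdeleRing (𝓞 E) E)).2 v) * Valued.v ((((((diagUnit b.2 1)⁻¹ * diagUnit b.2 2 : (AdeleRing (𝓞 E) E)ˣ)) : AdeleRing (𝓞 E) E)).2 v) * Valued.v ((coordX (⟨(((torusPart b)⁻¹ * b : borelAdelic F E c 3) : (quasiSplit F E c 3).Adelic), torusPart_inv_mul_mem_adelicUnipotent b⟩ :
            adelicUnipotent F E c 3)).2 v) ≤ idealRadius E v 𝔫 ∧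
      Valued.v ((((((diagUnit t.2 0)⁻¹ * diagUnit t.2 1 : (AdeleRing (𝓞 E) E)ˣ)) : AdeleRing (𝓞 E) E)).2 v) * Valued.v ((((((diagUnit b.2 0)⁻¹ * diagUnit b.2 1 : (AdeleRing (𝓞 E) E)ˣ)) : AdeleRing (𝓞 E) E)).2 v) * Valued.v ((conjAdele F E c (coordX (⟨(((torusPart b)⁻¹ * b : borelAdelic F E c 3) : (quasiSplit F E c 3).Adelic), torusPart_inv_mul_mem_adelicUnipotent b⟩ :
            adelicUnipotent F E c 3))).2 v) ≤ idealRadius E v 𝔫) →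
          (∀ v : HeightOneSpectrum (𝓞 E),
      Valued.v ((((((diagUnit t.2 0)⁻¹ * diagUnit t.2 1 : (AdeleRing (𝓞 E) E)ˣ)) : AdeleRing (𝓞 E) E)).2 v) * Valued.v ((((((diagUnit b.2 0)⁻¹ * diagUnit b.2 1 : (AdeleRing (𝓞 E) E)ˣ)) : AdeleRing (𝓞 E) E)).2 v) ≤ idealRadius E v (c⁻¹ • 𝔫) ∧
      Valued.v ((((((diagUnit t.2 0)⁻¹ * diagUnit t.2 1 : (AdeleRing (𝓞 E) E)ˣ)) : AdeleRing (𝓞 E) E)).2 v) * Valued.v ((((((diagUnit b.2 1)⁻¹ * diagUnit b.2 2 : (AdeleRing (𝓞 E) E)ˣ)) : AdeleRing (𝓞 E) E)).2 v) ≤ idealRadius E v (c⁻¹ • 𝔫) ∧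
      Valued.v ((((((diagUnit t.2 0)⁻¹ * diagUnit t.2 1 : (AdeleRing (𝓞 E) E)ˣ)) : AdeleRing (𝓞 E) E)).2 v) * Valued.v ((((((diagUnit t.2 0)⁻¹ * diagUnit t.2 1 : (AdeleRing (𝓞 E) E)ˣ)) : AdeleRing (𝓞 E) E)).2 v) * Valued.v ((((((diagUnit b.2 0)⁻¹ * diagUnit b.2 2 : (AdeleRing (𝓞 E) E)ˣ)) : AdeleRing (𝓞 E) E)).2 v) *
          Valued.v ((halfAdele : AdeleRing (𝓞 E) E).2 v) ≤ idealRadius E v (c⁻¹ • 𝔫) ∧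
      Valued.v ((((((diagUnit t.2 0)⁻¹ * diagUnit t.2 1 : (AdeleRing (𝓞 E) E)ˣ)) : AdeleRing (𝓞 E) E)).2 v) * Valued.v ((((((diagUnit b.2 1)⁻¹ * diagUnit b.2 2 : (AdeleRing (𝓞 E) E)ˣ)) : AdeleRing (𝓞 E) E)).2 v) * Valued.v ((coordX (⟨(((torusPart b)⁻¹ * b : borelAdelic F E c 3) : (quasiSplit F E c 3).Adelic), torusPart_inv_mul_mem_adelicUnipotent b⟩ :
            adelicUnipotent F E c 3)).2 v) ≤ idealRadius E v (c⁻¹ • 𝔫) ∧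
      Valued.v ((((((diagUnit t.2 0)⁻¹ * diagUnit t.2 1 : (AdeleRing (𝓞 E) E)ˣ)) : AdeleRing (𝓞 E) E)).2 v) * Valued.v ((((((diagUnit b.2 0)⁻¹ * diagUnit b.2 1 : (AdeleRing (𝓞 E) E)ˣ)) : AdeleRing (𝓞 E) E)).2 v) * Valued.v ((conjAdele F E c (coordX (⟨(((torusPart b)⁻¹ * b : borelAdelic F E c 3) : (quasiSplit F E c 3).Adelic), torusPart_inv_mul_mem_adelicUnipotent b⟩ :
            adelicUnipotent F E c 3))).2 v) ≤ idealRadius E v (c⁻¹ • 𝔫)) →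
          ∀ u ∈ (fun v : adelicUnipotent F E c 3 => (⟨(t : (quasiSplit F E c 3).Adelic)⁻¹ * (v : (quasiSplit F E c 3).Adelic) * (t : (quasiSplit F E c 3).Adelic),
        borel_inv_mul_mul_mem_adelicUnipotent t v⟩ : adelicUnipotent F E c 3)) '' heisFundamentalDomain F E c hc,
          ∃ (t₁ t₂ t₃ : ℝ) (X₁ X₂ X₃ : Matrix (Fin 3) (Fin 3) (mixedSpace E)) (w : GL (Fin 3) (AdeleRing (𝓞 E) E)),
            X₁ ∈ S ∧ X₂ ∈ S ∧ X₃ ∈ S ∧ w ∈ principalCongruenceLevel 3 E 𝔫 ∧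
            |t₁| ≤ C * max (max ‖archHom E ((((diagUnit b.2 0)⁻¹ * diagUnit b.2 1 : (AdeleRing (𝓞 E) E)ˣ)) : AdeleRing (𝓞 E) E)‖
              ‖archHom E ((((diagUnit b.2 0)⁻¹ * diagUnit b.2 2 : (AdeleRing (𝓞 E) E)ˣ)) : AdeleRing (𝓞 E) E)‖)
              ‖archHom E ((((diagUnit b.2 1)⁻¹ * diagUnit b.2 2 : (AdeleRing (𝓞 E) E)ˣ)) : AdeleRing (𝓞 E) E)‖ ∧
            |t₂| ≤ C * max (max ‖archHom E ((((diagUnit b.2 0)⁻¹ * diagUnit b.2 1 : (AdeleRing (𝓞 E) E)ˣ)) : AdeleRing (𝓞 E) E)‖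
              ‖archHom E ((((diagUnit b.2 0)⁻¹ * diagUnit b.2 2 : (AdeleRing (𝓞 E) E)ˣ)) : AdeleRing (𝓞 E) E)‖)
              ‖archHom E ((((diagUnit b.2 1)⁻¹ * diagUnit b.2 2 : (AdeleRing (𝓞 E) E)ˣ)) : AdeleRing (𝓞 E) E)‖ ∧
            |t₃| ≤ C * max (max ‖archHom E ((((diagUnit b.2 0)⁻¹ * diagUnit b.2 1 : (AdeleRing (𝓞 E) E)ˣ)) : AdeleRing (𝓞 E) E)‖
              ‖archHom E ((((diagUnit b.2 0)⁻¹ * diagUnit b.2 2 : (AdeleRing (𝓞 E) E)ˣ)) : AdeleRing (𝓞 E) E)‖)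
              ‖archHom E ((((diagUnit b.2 1)⁻¹ * diagUnit b.2 2 : (AdeleRing (𝓞 E) E)ˣ)) : AdeleRing (𝓞 E) E)‖ ∧
            adelicVal F E c 3 _ (((b : (quasiSplit F E c 3).Adelic) * k)⁻¹ * (u : (quasiSplit F E c 3).Adelic) * ((b : (quasiSplit F E c 3).Adelic) * k)) =
              GLn.ofInfinite 3 E (expGL (t₁ • X₁) * expGL (t₂ • X₂) * expGL (t₃ • X₃)) * w := by
  obtain ⟨KN, hKN, hsub⟩ := exists_isCompact_borelConj_heisFundamentalDomain_subset (F := F) (E := E) (c := c) hc t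
  obtain ⟨S, hS, C, hC0, hmain⟩ := exists_isCompact_forall_threeFactor (F := F) (E := E) (c := c) hc hKN hΩ
  refine ⟨S, hS, C, hC0, fun b k hk hn₀ 𝔫 hval hval' u hu => ?_⟩
  exact hmain b k hk hn₀ 𝔫 u (hsub hu) (hval_of_mem_torusConj_image hc t ht hfix b 𝔫 hval hval' hu)

/-! ## §4 The rational dilation `t_m = diag(m⁻¹, 1, m)`, `m ∈ F×` -/

/-- **THE THREE-FACTOR NORMAL FORM ON `𝓕_m = t_m⁻¹ 𝓕_N t_m`, `m ∈ F×`** (★ `exists_rational_torus_diag`): `t_m` is rational and diagonal (so `𝓕_m` is an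
`N(F)`-fundamental domain, ★ `isFundamentalDomain_borelConj_image`), its root value is the principal adèle `m` (`c`-fixed), and the five inequalities read
`|m|_v|d₀⁻¹d₁|_v ≤ |𝔫|_v`, `|m|_v|d₁⁻¹d₂|_v ≤ |𝔫|_v`, `|m|_v²|d₀⁻¹d₂|_v|½|_v ≤ |𝔫|_v`, `|m|_v|d₁⁻¹d₂|_v|x₀|_v ≤ |𝔫|_v`, `|m|_v|d₀⁻¹d₁|_v|c(x₀)|_v ≤ |𝔫|_v`.
[cite: Rogawski1990, §2.2 (p. 13)] -/
theorem exists_rational_torus_threeFactor (hc : c * c = 1) (m : F) (hm : m ≠ 0)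
    {Ω : Set (adelicUnipotent F E c 3)} (hΩ : IsCompact Ω) :
    ∃ t : borelAdelic F E c 3, (t : (quasiSplit F E c 3).Adelic) ∈ (quasiSplit F E c 3).arithmeticSubgroup ∧
      (t : (quasiSplit F E c 3).Adelic) ∈ torusAdelic F E c 3 ∧
      ((((diagUnit t.2 0)⁻¹ * diagUnit t.2 1 : (AdeleRing (𝓞 E) E)ˣ)) : AdeleRing (𝓞 E) E) = (algebraMap E (AdeleRing (𝓞 E) E) (algebraMap F E m)) ∧
      ((((diagUnit t.2 0)⁻¹ * diagUnit t.2 2 : (AdeleRing (𝓞 E) E)ˣ)) : AdeleRing (𝓞 E) E) = (algebraMap E (AdeleRing (𝓞 E) E) (algebraMap F E m)) * (algebraMap E (AdeleRing (𝓞 E) E) (algebraMap F E m)) ∧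
    ∃ S : Set (Matrix (Fin 3) (Fin 3) (mixedSpace E)), IsCompact S ∧ ∃ C : ℝ, 0 ≤ C ∧
      ∀ (b : borelAdelic F E c 3) (k : (quasiSplit F E c 3).Adelic),
        adelicVal F E c 3 _ k ∈ standardMaximalCompactGL 3 E →
        (⟨(((torusPart b)⁻¹ * b : borelAdelic F E c 3) : (quasiSplit F E c 3).Adelic), torusPart_inv_mul_mem_adelicUnipotent b⟩ :
          adelicUnipotent F E c 3) ∈ Ω →
        ∀ 𝔫 : Ideal (𝓞 E),
          (∀ v : HeightOneSpectrum (𝓞 E),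
      Valued.v ((algebraMap E (AdeleRing (𝓞 E) E) (algebraMap F E m)).2 v) * Valued.v ((((((diagUnit b.2 0)⁻¹ * diagUnit b.2 1 : (AdeleRing (𝓞 E) E)ˣ)) : AdeleRing (𝓞 E) E)).2 v) ≤ idealRadius E v 𝔫 ∧
      Valued.v ((algebraMap E (AdeleRing (𝓞 E) E) (algebraMap F E m)).2 v) * Valued.v ((((((diagUnit b.2 1)⁻¹ * diagUnit b.2 2 : (AdeleRing (𝓞 E) E)ˣ)) : AdeleRing (𝓞 E) E)).2 v) ≤ idealRadius E v 𝔫 ∧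
      Valued.v ((algebraMap E (AdeleRing (𝓞 E) E) (algebraMap F E m)).2 v) * Valued.v ((algebraMap E (AdeleRing (𝓞 E) E) (algebraMap F E m)).2 v) * Valued.v ((((((diagUnit b.2 0)⁻¹ * diagUnit b.2 2 : (AdeleRing (𝓞 E) E)ˣ)) : AdeleRing (𝓞 E) E)).2 v) *
          Valued.v ((halfAdele : AdeleRing (𝓞 E) E).2 v) ≤ idealRadius E v 𝔫 ∧
      Valued.v ((algebraMap E (AdeleRing (𝓞 E) E) (algebraMap F E m)).2 v) * Valued.v ((((((diagUnit b.2 1)⁻¹ * diagUnit b.2 2 : (AdeleRing (𝓞 E) E)ˣ)) : AdeleRing (𝓞 E) E)).2 v) * Valued.v ((coordX (⟨(((torusPart b)⁻¹ * b : borelAdelic F E c 3) : (quasiSplit F E c 3).Adelic), torusPart_inv_mul_mem_adelicUnipotent b⟩ :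
            adelicUnipotent F E c 3)).2 v) ≤ idealRadius E v 𝔫 ∧
      Valued.v ((algebraMap E (AdeleRing (𝓞 E) E) (algebraMap F E m)).2 v) * Valued.v ((((((diagUnit b.2 0)⁻¹ * diagUnit b.2 1 : (AdeleRing (𝓞 E) E)ˣ)) : AdeleRing (𝓞 E) E)).2 v) * Valued.v ((conjAdele F E c (coordX (⟨(((torusPart b)⁻¹ * b : borelAdelic F E c 3) : (quasiSplit F E c 3).Adelic), torusPart_inv_mul_mem_adelicUnipotent b⟩ :
            adelicUnipotent F E c 3))).2 v) ≤ idealRadius E v 𝔫) →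
          (∀ v : HeightOneSpectrum (𝓞 E),
      Valued.v ((algebraMap E (AdeleRing (𝓞 E) E) (algebraMap F E m)).2 v) * Valued.v ((((((diagUnit b.2 0)⁻¹ * diagUnit b.2 1 : (AdeleRing (𝓞 E) E)ˣ)) : AdeleRing (𝓞 E) E)).2 v) ≤ idealRadius E v (c⁻¹ • 𝔫) ∧
      Valued.v ((algebraMap E (AdeleRing (𝓞 E) E) (algebraMap F E m)).2 v) * Valued.v ((((((diagUnit b.2 1)⁻¹ * diagUnit b.2 2 : (AdeleRing (𝓞 E) E)ˣ)) : AdeleRing (𝓞 E) E)).2 v) ≤ idealRadius E v (c⁻¹ • 𝔫) ∧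
      Valued.v ((algebraMap E (AdeleRing (𝓞 E) E) (algebraMap F E m)).2 v) * Valued.v ((algebraMap E (AdeleRing (𝓞 E) E) (algebraMap F E m)).2 v) * Valued.v ((((((diagUnit b.2 0)⁻¹ * diagUnit b.2 2 : (AdeleRing (𝓞 E) E)ˣ)) : AdeleRing (𝓞 E) E)).2 v) *
          Valued.v ((halfAdele : AdeleRing (𝓞 E) E).2 v) ≤ idealRadius E v (c⁻¹ • 𝔫) ∧
      Valued.v ((algebraMap E (AdeleRing (𝓞 E) E) (algebraMap F E m)).2 v) * Valued.v ((((((diagUnit b.2 1)⁻¹ * diagUnit b.2 2 : (AdeleRing (𝓞 E) E)ˣ)) : AdeleRing (𝓞 E) E)).2 v) * Valued.v ((coordX (⟨(((torusPart b)⁻¹ * b : borelAdelic F E c 3) : (quasiSplit F E c 3).Adelic), torusPart_inv_mul_mem_adelicUnipotent b⟩ :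
            adelicUnipotent F E c 3)).2 v) ≤ idealRadius E v (c⁻¹ • 𝔫) ∧
      Valued.v ((algebraMap E (AdeleRing (𝓞 E) E) (algebraMap F E m)).2 v) * Valued.v ((((((diagUnit b.2 0)⁻¹ * diagUnit b.2 1 : (AdeleRing (𝓞 E) E)ˣ)) : AdeleRing (𝓞 E) E)).2 v) * Valued.v ((conjAdele F E c (coordX (⟨(((torusPart b)⁻¹ * b : borelAdelic F E c 3) : (quasiSplit F E c 3).Adelic), torusPart_inv_mul_mem_adelicUnipotent b⟩ :
            adelicUnipotent F E c 3))).2 v) ≤ idealRadius E v (c⁻¹ • 𝔫)) →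
          ∀ u ∈ (fun v : adelicUnipotent F E c 3 => (⟨(t : (quasiSplit F E c 3).Adelic)⁻¹ * (v : (quasiSplit F E c 3).Adelic) * (t : (quasiSplit F E c 3).Adelic),
          borel_inv_mul_mul_mem_adelicUnipotent t v⟩ : adelicUnipotent F E c 3)) '' heisFundamentalDomain F E c hc,
          ∃ (t₁ t₂ t₃ : ℝ) (X₁ X₂ X₃ : Matrix (Fin 3) (Fin 3) (mixedSpace E)) (w : GL (Fin 3) (AdeleRing (𝓞 E) E)),
            X₁ ∈ S ∧ X₂ ∈ S ∧ X₃ ∈ S ∧ w ∈ principalCongruenceLevel 3 E 𝔫 ∧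
            |t₁| ≤ C * max (max ‖archHom E ((((diagUnit b.2 0)⁻¹ * diagUnit b.2 1 : (AdeleRing (𝓞 E) E)ˣ)) : AdeleRing (𝓞 E) E)‖
              ‖archHom E ((((diagUnit b.2 0)⁻¹ * diagUnit b.2 2 : (AdeleRing (𝓞 E) E)ˣ)) : AdeleRing (𝓞 E) E)‖)
              ‖archHom E ((((diagUnit b.2 1)⁻¹ * diagUnit b.2 2 : (AdeleRing (𝓞 E) E)ˣ)) : AdeleRing (𝓞 E) E)‖ ∧
            |t₂| ≤ C * max (max ‖archHom E ((((diagUnit b.2 0)⁻¹ * diagUnit b.2 1 : (AdeleRing (𝓞 E) E)ˣ)) : AdeleRing (𝓞 E) E)‖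
              ‖archHom E ((((diagUnit b.2 0)⁻¹ * diagUnit b.2 2 : (AdeleRing (𝓞 E) E)ˣ)) : AdeleRing (𝓞 E) E)‖)
              ‖archHom E ((((diagUnit b.2 1)⁻¹ * diagUnit b.2 2 : (AdeleRing (𝓞 E) E)ˣ)) : AdeleRing (𝓞 E) E)‖ ∧
            |t₃| ≤ C * max (max ‖archHom E ((((diagUnit b.2 0)⁻¹ * diagUnit b.2 1 : (AdeleRing (𝓞 E) E)ˣ)) : AdeleRing (𝓞 E) E)‖
              ‖archHom E ((((diagUnit b.2 0)⁻¹ * diagUnit b.2 2 : (AdeleRing (𝓞 E) E)ˣ)) : AdeleRing (𝓞 E) E)‖)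
              ‖archHom E ((((diagUnit b.2 1)⁻¹ * diagUnit b.2 2 : (AdeleRing (𝓞 E) E)ˣ)) : AdeleRing (𝓞 E) E)‖ ∧
            adelicVal F E c 3 _ (((b : (quasiSplit F E c 3).Adelic) * k)⁻¹ * (u : (quasiSplit F E c 3).Adelic) * ((b : (quasiSplit F E c 3).Adelic) * k)) =
              GLn.ofInfinite 3 E (expGL (t₁ • X₁) * expGL (t₂ • X₂) * expGL (t₃ • X₃)) * w := by
  obtain ⟨t, hrat, htor, hd0, hd1, -⟩ := exists_rational_torus_diag (F := F) (E := E) (c := c) m hm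
  have hmE : algebraMap F E m ≠ 0 := (map_ne_zero (algebraMap F E)).2 hm
  -- the root value `d₀⁻¹ d₁ = m`
  have hM : ((((diagUnit t.2 0)⁻¹ * diagUnit t.2 1 : (AdeleRing (𝓞 E) E)ˣ)) : AdeleRing (𝓞 E) E) = (algebraMap E (AdeleRing (𝓞 E) E) (algebraMap F E m)) := by
    have hinv : (((diagUnit t.2 0)⁻¹ : (AdeleRing (𝓞 E) E)ˣ) : AdeleRing (𝓞 E) E) = (algebraMap E (AdeleRing (𝓞 E) E) (algebraMap F E m)) := by
      refine Units.inv_eq_of_mul_eq_one_left ?_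
      rw [hd0, ← map_mul, mul_inv_cancel₀ hmE, map_one]
    rw [Units.val_mul, hinv, hd1, mul_one]
  have hfix : conjAdele F E c ((((diagUnit t.2 0)⁻¹ * diagUnit t.2 1 : (AdeleRing (𝓞 E) E)ˣ)) : AdeleRing (𝓞 E) E) =
      ((((diagUnit t.2 0)⁻¹ * diagUnit t.2 1 : (AdeleRing (𝓞 E) E)ˣ)) : AdeleRing (𝓞 E) E) := by
    rw [hM, ← algebraMap_conj, RingHom.coe_coe, AlgEquiv.commutes]
  obtain ⟨hcα, hαγ⟩ := conjAdele_rootOne_eq (F := F) (E := E) (c := c) t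
  have hM2 : ((((diagUnit t.2 0)⁻¹ * diagUnit t.2 2 : (AdeleRing (𝓞 E) E)ˣ)) : AdeleRing (𝓞 E) E) = (algebraMap E (AdeleRing (𝓞 E) E) (algebraMap F E m)) * (algebraMap E (AdeleRing (𝓞 E) E) (algebraMap F E m)) := by
    rw [← hαγ, ← hcα, hfix, hM]
  obtain ⟨S, hS, C, hC0, hmain⟩ := exists_isCompact_forall_threeFactor_dilated (F := F) (E := E) (c := c) hc t htor hfix hΩ
  refine ⟨t, hrat, htor, hM, hM2, S, hS, C, hC0, fun b k hk hn₀ 𝔫 hval hval' u hu =>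
    hmain b k hk hn₀ 𝔫 (fun v => ?_) (fun v => ?_) u hu⟩
  · rw [hM]; exact hval v
  · rw [hM]; exact hval' v

end UnitaryGroup

end Literature.NumberTheory.Automorphic

end
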